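import Summits.ValiantsHypothesis.ValiantsHypothesis.Theorems.FifoMatchingNNDivisionHardExactPencilZgenFace
import HarnessLib

/-!
# EXACT PENCILS V — ★★★ zero-diagonal difference cubes are DECIDED by C′ at the transversal face (pins, common maximiser `H⋆`, `UDISJ_k`, rate) (crux `NNDivisionHard`, stmt-ValiantsHypothesis-21181) — `ExactPencil` port part 5/12

Theorems-side port (staged by val-idea-40 g6, C′-census owner per director-valiant R331 (2)(e) / desk #399, for the port hands;
press as `Theorems/FifoMatchingNNDivisionHardExactPencilZgenCube.lean`, `--kind proof --supports stmt-ValiantsHypothesis-21181 --as helper`; sig-first val-idea-crit-9 g3) of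
§9 (second part: pins and the `Cube` subsection) of val-idea-38 g2's crux workfile `Cruxes/NNDivisionHard/ExactPencil38.lean` REV 16 @4e81d1716f6b (sha16 d9f2e288279a0b09, 3 456 l., FROZEN — final from 38 g2, bus 01:14:51Z; critic of record val-idea-crit-9 g2/g3: `CRITIC-wave6.md` FINAL + V#97 §2 «rev 14/15 δ KERNEL VERIFIED»).  Declaration texts VERBATIM (namespace
`…Theorems.FifoMatching.ExactPencil`; one-line docstrings added where the source had none); the 40-g5 tools the source RESTATED are
DROPPED here and cited BY NAME from the landed ports `…Theorems.FifoMatching.LocatedRows.*` (✓ p680125 … p683387: `T`, `RowFamily`,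
`hCOR`, `exactTilted`, `ExactPencilLaw`, `pinnedRows`, `unflat`, `three_pow_le_of_block`, `two_pow_half_mul_le`, `zgen`, `cubePt`, …) and
`…Theorems.FifoMatching.XcDivision` (`udRow`, `udPt`, `udInd`, `udMat`, …), so that C′ stays ONE Theorems declaration
`LocatedRows.ExactPencilLaw`.  Part 5/12 of the port (imports part 4, `…Theorems.FifoMatchingNNDivisionHardExactPencilZgenFace`).

* `Wz_dotProduct_zgen`, `val_lt_of_mem_map_ι₁e`, ★ `zscore_sign`, `kOf`/`lOf`/`mOf`/`of_spec`, `δz`, `Hz` (`H⋆`), `zscore_nonneg_of_mem`,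
  `zscore_nonpos_of_not_mem`, ★ `zsc_le_star`, ★★ `exactTilted_block_zgenCube`, ★★★ `exactTilted_law_holds_on_zgenCube`,
  ★★★ `cor_add_zgenCube_decided` (`COR(n) + Q` for every zgen cube `Q`: `T c n < r` eventually).

HONEST LABEL: every theorem here is a DECIDED SPECIES / support lemma for the OPEN law C′ = `LocatedRows.ExactPencilLaw`
(`exactTilted.Law`); the crux 21181 `NNDivisionHard`, C′, `allRows.Law` and COR-VIRTUAL are OPEN; C⁺_entry `LocatedPencilLaw` is
REFUTED (✓ p679540).  VP ≠ VNP is NOT proved here or anywhere in this tree.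
-/

set_option autoImplicit false

-- the mandated summit-side namespace repeats a component by design (single-problem summit)
set_option linter.dupNamespace false

noncomputable section

open Matrix Finset
open scoped Pointwise

namespace Summit.ValiantsHypothesis.ValiantsHypothesis.Theorems.FifoMatching.ExactPencil

open Literature.Barriers.PneNP (HasEFOfSize three_pow_le_card_mul_two_pow_of_cover_univ)
open Literature.Combinatorics.Optimization.FixedSizePsdRank
  (corPolytope flat vecOuter flat_dotProduct_le_of_mem_corPolytope flat_dotProduct_vecOuter)
open Summit.ValiantsHypothesis.ValiantsHypothesis.Theorems.FifoMatching.XcDivision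
  (udRow udPt udInd udMat ud_data udInd_apply udInd_sq dot_le_of_mem_convexHull flat_dotProduct_flat)
open Summit.ValiantsHypothesis.ValiantsHypothesis.Theorems.FifoMatching.LocatedRows
  (T CorVirtualHardN RowFamily corVirtualHardN_of_law flat_le_box entryTilted allRows LocatedPencilLaw
    hCOR le_hCOR exists_eq_hCOR flat_le_hCOR hCOR_le_box exactTilted ExactPencilLaw exactTilted_emb_allRows
    corVirtualHardN_of_exactPencilLaw three_pow_le_of_block two_pow_half_mul_le pinnedRows unflat flat_unflat
    pinnedRows_emb_exactTilted corVirtualHardN_of_pinnedRowsLaw zgen cubePt dotProduct_cubePt)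

section ZgenCube
variable {n : ℕ}

/-! ### pins and the common maximiser `H⋆` on the block rows -/

/-- `⟨W^z, E^s_{kl} − E^s_{km}⟩ = 2(W^z_{kl} − W^z_{km})`. -/
theorem Wz_dotProduct_zgen {k l m : Fin n} (hkl : k ≠ l) (hkm : k ≠ m) :
    flat (Wz n) ⬝ᵥ flat (zgen k l m) = 2 * (Wz n k l - Wz n k m) := by
  rw [flat_dotProduct_zgen _ hkl hkm, Wz_symm l k, Wz_symm m k]; ring

/-- elements of `ι₁(a')` lie in the first half. -/
theorem val_lt_of_mem_map_ι₁e {a' : Finset (Fin (kk n))} {x : Fin n} (hx : x ∈ a'.map (ι₁e n)) : (x : ℕ) < kk n := by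
  obtain ⟨u, -, rfl⟩ := Finset.mem_map.mp hx
  exact u.2

/-- ★ the SCORE of one difference generator against a block row `(ι₁(a'), W^z)`: nonnegative iff the rule `δ > 0 ∨ (δ = 0 ∧ m ∈ L)` says IN. -/
theorem zscore_sign (a' : Finset (Fin (kk n))) {k l m : Fin n} (hkl : k ≠ l) (hkm : k ≠ m) (hlm : l ≠ m) :
    ((0 < Wz n k l - Wz n k m ∨ (Wz n k l - Wz n k m = 0 ∧ (m : ℕ) < kk n)) →
        0 ≤ (udRow (a'.map (ι₁e n)) + flat (Wz n)) ⬝ᵥ flat (zgen k l m)) ∧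
    (¬ (0 < Wz n k l - Wz n k m ∨ (Wz n k l - Wz n k m = 0 ∧ (m : ℕ) < kk n)) →
        (udRow (a'.map (ι₁e n)) + flat (Wz n)) ⬝ᵥ flat (zgen k l m) ≤ 0) := by
  classical
  set a := a'.map (ι₁e n)
  have hcw := abs_udRow_dotProduct_zgen_le a hkl hkm
  have htri := Wz_sub_trichotomy (n := n) k l m
  rw [add_dotProduct, Wz_dotProduct_zgen hkl hkm]
  constructor
  · rintro (hpos | ⟨hzero, hmL⟩)
    · rcases htri with h | h | h <;> linarith
    · rw [hzero, udRow_dotProduct_zgen a hkl hkm, udInd_apply, udInd_apply, udInd_apply]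
      by_cases hka : k ∈ a
      · by_cases hla : l ∈ a
        · exact absurd hzero (Wz_sub_ne_zero_of_lt (val_lt_of_mem_map_ι₁e hka) (val_lt_of_mem_map_ι₁e hla) hmL hkl hkm hlm)
        · rw [if_pos hka, if_neg hla]; split_ifs <;> norm_num
      · rw [if_neg hka]; simp
  · intro hnot
    push Not at hnot
    obtain ⟨hle, hzero_imp⟩ := hnot
    rcases htri with h | h | h
    · linarith
    · have hm : kk n ≤ (m : ℕ) := hzero_imp h
      have hma : m ∉ a := fun hma => absurd (val_lt_of_mem_map_ι₁e hma) (by omega)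
      rw [h, udRow_dotProduct_zgen a hkl hkm, udInd_apply a m, if_neg hma, udInd_apply, udInd_apply]
      split_ifs <;> norm_num
    · linarith

/-! ### the common maximiser over a zgen cube -/

section Cube
variable {N : ℕ} {G : Fin N → Matrix (Fin n) (Fin n) ℝ}

/-- the indices `k_t, l_t, m_t` of generator `t` (a choice). -/
noncomputable def kOf (hz : IsZgenCube G) (t : Fin N) : Fin n := Classical.choose (hz t)
/-- the second index `l` of the generator `G t = E^s_{kl} − E^s_{km}` (a choice). -/
noncomputable def lOf (hz : IsZgenCube G) (t : Fin N) : Fin n := Classical.choose (Classical.choose_spec (hz t))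
/-- the third index `m` of the generator `G t = E^s_{kl} − E^s_{km}` (a choice). -/
noncomputable def mOf (hz : IsZgenCube G) (t : Fin N) : Fin n :=
  Classical.choose (Classical.choose_spec (Classical.choose_spec (hz t)))

/-- the chosen indices are pairwise distinct and present `G t` as `zgen (kOf t) (lOf t) (mOf t)`. -/
theorem of_spec (hz : IsZgenCube G) (t : Fin N) :
    kOf hz t ≠ lOf hz t ∧ kOf hz t ≠ mOf hz t ∧ lOf hz t ≠ mOf hz t ∧ G t = zgen (kOf hz t) (lOf hz t) (mOf hz t) :=
  Classical.choose_spec (Classical.choose_spec (Classical.choose_spec (hz t)))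

/-- the pencil difference `δ_t = W^z_{k l} − W^z_{k m}` of generator `t`. -/
noncomputable def δz (hz : IsZgenCube G) (t : Fin N) : ℝ := Wz n (kOf hz t) (lOf hz t) - Wz n (kOf hz t) (mOf hz t)

/-- ★ the COMMON MAXIMISER `H⋆ = {t : δ_t > 0} ∪ {t : δ_t = 0 ∧ m_t ∈ L}` of all block rows. -/
noncomputable def Hz (hz : IsZgenCube G) : Finset (Fin N) :=
  Finset.univ.filter (fun t => 0 < δz hz t ∨ (δz hz t = 0 ∧ ((mOf hz t : Fin n) : ℕ) < kk n))

/-- membership in the common maximiser `H⋆`: `δz > 0`, or `δz = 0` with `m` in the first half. -/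
theorem mem_Hz (hz : IsZgenCube G) (t : Fin N) :
    t ∈ Hz hz ↔ (0 < δz hz t ∨ (δz hz t = 0 ∧ ((mOf hz t : Fin n) : ℕ) < kk n)) := by
  simp [Hz]

/-- scores are `≥ 0` on `H⋆` for every block row `ι₁(a')`. -/
theorem zscore_nonneg_of_mem (hz : IsZgenCube G) (a' : Finset (Fin (kk n))) {t : Fin N} (ht : t ∈ Hz hz) :
    0 ≤ (udRow (a'.map (ι₁e n)) + flat (Wz n)) ⬝ᵥ flat (G t) := by
  obtain ⟨hkl, hkm, hlm, hG⟩ := of_spec hz t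
  rw [hG]
  exact (zscore_sign a' hkl hkm hlm).1 ((mem_Hz hz t).mp ht)

/-- scores are `≤ 0` off `H⋆` for every block row `ι₁(a')`. -/
theorem zscore_nonpos_of_not_mem (hz : IsZgenCube G) (a' : Finset (Fin (kk n))) {t : Fin N} (ht : t ∉ Hz hz) :
    (udRow (a'.map (ι₁e n)) + flat (Wz n)) ⬝ᵥ flat (G t) ≤ 0 := by
  obtain ⟨hkl, hkm, hlm, hG⟩ := of_spec hz t
  rw [hG]
  exact (zscore_sign a' hkl hkm hlm).2 (fun h => ht ((mem_Hz hz t).mpr h))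

/-- ★ `H⋆` maximises EVERY block row `(ι₁(a'), W^z)` over the cube (base point and multiplicities irrelevant). -/
theorem zsc_le_star (hz : IsZgenCube G) (Q₀ : Matrix (Fin n) (Fin n) ℝ) (a' : Finset (Fin (kk n))) (P : Finset (Fin N)) :
    (udRow (a'.map (ι₁e n)) + flat (Wz n)) ⬝ᵥ cubePt Q₀ G P ≤
      (udRow (a'.map (ι₁e n)) + flat (Wz n)) ⬝ᵥ cubePt Q₀ G (Hz hz) := by
  classical
  set ρ := udRow (a'.map (ι₁e n)) + flat (Wz n)
  rw [dotProduct_cubePt, dotProduct_cubePt]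
  have hsplit := Finset.sum_filter_add_sum_filter_not P (fun t => t ∈ Hz hz) (fun t => ρ ⬝ᵥ flat (G t))
  have hneg : ∑ t ∈ P.filter (fun t => t ∉ Hz hz), ρ ⬝ᵥ flat (G t) ≤ 0 :=
    Finset.sum_nonpos fun t ht => zscore_nonpos_of_not_mem hz a' (Finset.mem_filter.mp ht).2
  have hsub : P.filter (fun t => t ∈ Hz hz) ⊆ Hz hz := fun t ht => (Finset.mem_filter.mp ht).2
  have hmono : ∑ t ∈ P.filter (fun t => t ∈ Hz hz), ρ ⬝ᵥ flat (G t) ≤ ∑ t ∈ Hz hz, ρ ⬝ᵥ flat (G t) :=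
    Finset.sum_le_sum_of_subset_of_nonneg hsub fun t ht _ => zscore_nonneg_of_mem hz a' ht
  linarith

/-! ### ★★★ the theorems -/

/-- the block engine, columns indexed by subsets `P ⊆ [N]` directly (no budget hypothesis). -/
theorem exactTilted_block_zgenCube (c : ℕ) : ∃ n₀ : ℕ, ∀ n ≥ n₀, ∀ (N : ℕ) (Q₀ : Matrix (Fin n) (Fin n) ℝ)
    (G : Fin N → Matrix (Fin n) (Fin n) ℝ), IsZgenCube G → ∀ (r : ℕ)
    (mm : exactTilted.A n → ℝ), (∀ a P, exactTilted.ρ n a ⬝ᵥ cubePt Q₀ G P ≤ mm a) →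
      (∀ a, ∃ P, exactTilted.ρ n a ⬝ᵥ cubePt Q₀ G P = mm a) →
    ∀ (U : exactTilted.A n → Option (Fin r) → ℝ) (V : Finset (Fin n) × Finset (Fin N) → Option (Fin r) → ℝ),
      (∀ a i, 0 ≤ U a i) → (∀ p i, 0 ≤ V p i) →
      (∀ a b P, (exactTilted.β n a + mm a) - exactTilted.ρ n a ⬝ᵥ (udPt b + cubePt Q₀ G P) = ∑ i, U a i * V (b, P) i) →
      T c n < r := by
  classical
  obtain ⟨n₀, hn₀⟩ := T_lt_of_block_half c
  refine ⟨n₀, fun n hn N Q₀ G hz r mm hle hat U V hU hV hfac => hn₀ n hn r ?_⟩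
  let row : Finset (Fin (kk n)) → exactTilted.A n := fun a' => (a'.map (ι₁e n), Wz n)
  let col : Finset (Fin (kk n)) → Finset (Fin n) × Finset (Fin N) := fun S => (Bcol S, Hz hz)
  have hmm : ∀ a', mm (row a') = (udRow (a'.map (ι₁e n)) + flat (Wz n)) ⬝ᵥ cubePt Q₀ G (Hz hz) := by
    intro a'
    obtain ⟨P₀, hP₀⟩ := hat (row a')
    have h1 := hle (row a') (Hz hz)
    have h2 : exactTilted.ρ n (row a') ⬝ᵥ cubePt Q₀ G P₀ ≤ (udRow (a'.map (ι₁e n)) + flat (Wz n)) ⬝ᵥ cubePt Q₀ G (Hz hz) :=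
      zsc_le_star hz Q₀ _ P₀
    rw [hP₀] at h2
    exact le_antisymm h2 h1
  have key := three_pow_le_of_block (ι := Option (Fin r)) U V hU hV row col ?_
  · simpa [Fintype.card_option, Fintype.card_fin] using key
  · intro a' S
    rw [← hfac (row a') (Bcol S) (Hz hz), hmm a']
    show ((1 + hCOR (Wz n)) + (udRow (a'.map (ι₁e n)) + flat (Wz n)) ⬝ᵥ cubePt Q₀ G (Hz hz)) -
        (udRow (a'.map (ι₁e n)) + flat (Wz n)) ⬝ᵥ (udPt (Bcol S) + cubePt Q₀ G (Hz hz)) = (1 - ((a' ∩ S).card : ℝ)) ^ 2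
    rw [dotProduct_add, add_dotProduct _ _ (udPt (Bcol S)), hCOR_Wz, Wz_dotProduct_Bcol, ← ud_block a' S]
    ring

/-- ★★★ **`exactTilted.Law` HOLDS ON EVERY ZGEN CUBE** (Law currency). -/
theorem exactTilted_law_holds_on_zgenCube : ∀ c : ℕ, ∃ n₀ : ℕ, ∀ n ≥ n₀,
    ∀ (N K : ℕ) (Q₀ : Matrix (Fin n) (Fin n) ℝ) (G : Fin N → Matrix (Fin n) (Fin n) ℝ), IsZgenCube G →
    ∀ (e : Fin (K + 1) → Finset (Fin N)), Function.Surjective e → ∀ (r : ℕ),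
    HasEFOfSize (convexHull ℝ (Set.range (cubePt Q₀ G ∘ e))) r →
    ∀ mm : exactTilted.A n → ℝ, (∀ a j, exactTilted.ρ n a ⬝ᵥ (cubePt Q₀ G ∘ e) j ≤ mm a) →
      (∀ a, ∃ j, exactTilted.ρ n a ⬝ᵥ (cubePt Q₀ G ∘ e) j = mm a) →
    ∀ (U : exactTilted.A n → Option (Fin r) → ℝ) (V : Finset (Fin n) × Fin (K + 1) → Option (Fin r) → ℝ),
      (∀ a i, 0 ≤ U a i) → (∀ p i, 0 ≤ V p i) →
      (∀ a b j, (exactTilted.β n a + mm a) - exactTilted.ρ n a ⬝ᵥ (udPt b + (cubePt Q₀ G ∘ e) j) = ∑ i, U a i * V (b, j) i) →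
      T c n < r := by
  classical
  intro c
  obtain ⟨n₀, hn₀⟩ := T_lt_of_block_half c
  refine ⟨n₀, fun n hn N K Q₀ G hz e he r _ mm hle hat U V hU hV hfac => hn₀ n hn r ?_⟩
  obtain ⟨jstar, hj⟩ := he (Hz hz)
  let row : Finset (Fin (kk n)) → exactTilted.A n := fun a' => (a'.map (ι₁e n), Wz n)
  let col : Finset (Fin (kk n)) → Finset (Fin n) × Fin (K + 1) := fun S => (Bcol S, jstar)
  have hq : (cubePt Q₀ G ∘ e) jstar = cubePt Q₀ G (Hz hz) := by simp [hj]
  have hmm : ∀ a', mm (row a') = (udRow (a'.map (ι₁e n)) + flat (Wz n)) ⬝ᵥ cubePt Q₀ G (Hz hz) := by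
    intro a'
    obtain ⟨j₀, hj₀⟩ := hat (row a')
    have h1 := hle (row a') jstar
    rw [hq] at h1
    have h2 : exactTilted.ρ n (row a') ⬝ᵥ (cubePt Q₀ G ∘ e) j₀ ≤ (udRow (a'.map (ι₁e n)) + flat (Wz n)) ⬝ᵥ cubePt Q₀ G (Hz hz) :=
      zsc_le_star hz Q₀ _ (e j₀)
    rw [hj₀] at h2
    exact le_antisymm h2 h1
  have key := three_pow_le_of_block (ι := Option (Fin r)) U V hU hV row col ?_
  · simpa [Fintype.card_option, Fintype.card_fin] using key
  · intro a' S
    rw [← hfac (row a') (Bcol S) jstar, hq, hmm a']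
    show ((1 + hCOR (Wz n)) + (udRow (a'.map (ι₁e n)) + flat (Wz n)) ⬝ᵥ cubePt Q₀ G (Hz hz)) -
        (udRow (a'.map (ι₁e n)) + flat (Wz n)) ⬝ᵥ (udPt (Bcol S) + cubePt Q₀ G (Hz hz)) = (1 - ((a' ∩ S).card : ℝ)) ^ 2
    rw [dotProduct_add, add_dotProduct _ _ (udPt (Bcol S)), hCOR_Wz, Wz_dotProduct_Bcol, ← ud_block a' S]
    ring

/-- ★★★ **EVERY ZGEN CUBE IS DECIDED AT THE TOP LAW**: eventually in `n`, every extended formulation of `COR(n) + Q` — `Q` any affine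
cube whose generators are zero-diagonal differences `E^s_{kl} − E^s_{km}` (the `Z_mix` shape) — has size `> T c n` (indeed
`(3/2)^{⌊n/2⌋} ≤ r + 1`). -/
theorem cor_add_zgenCube_decided (c : ℕ) : ∃ n₀ : ℕ, ∀ n ≥ n₀, ∀ (N : ℕ) (Q₀ : Matrix (Fin n) (Fin n) ℝ)
    (G : Fin N → Matrix (Fin n) (Fin n) ℝ), IsZgenCube G → ∀ r : ℕ,
    HasEFOfSize (corPolytope n + convexHull ℝ (Set.range (cubePt Q₀ G))) r → T c n < r := by
  classical
  obtain ⟨n₀, hn₀⟩ := exactTilted_block_zgenCube c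
  refine ⟨n₀, fun n hn N Q₀ G hz r hEF => ?_⟩
  obtain ⟨pt_mem, -, -, -⟩ := ud_data n
  let mm : exactTilted.A n → ℝ := fun a =>
    Finset.univ.sup' Finset.univ_nonempty (fun P : Finset (Fin N) => exactTilted.ρ n a ⬝ᵥ cubePt Q₀ G P)
  have hat : ∀ a, ∃ P, exactTilted.ρ n a ⬝ᵥ cubePt Q₀ G P = mm a := fun a => by
    obtain ⟨P, -, hP⟩ := Finset.exists_mem_eq_sup' Finset.univ_nonempty
      (fun P : Finset (Fin N) => exactTilted.ρ n a ⬝ᵥ cubePt Q₀ G P)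
    exact ⟨P, hP.symm⟩
  have hle : ∀ a P, exactTilted.ρ n a ⬝ᵥ cubePt Q₀ G P ≤ mm a := fun a P =>
    Finset.le_sup' (fun P : Finset (Fin N) => exactTilted.ρ n a ⬝ᵥ cubePt Q₀ G P) (Finset.mem_univ P)
  have hm : ∀ a, ∀ y ∈ convexHull ℝ (Set.range (cubePt Q₀ G)), exactTilted.ρ n a ⬝ᵥ y ≤ mm a := fun a =>
    dot_le_of_mem_convexHull _ _ _ (by rintro _ ⟨P, rfl⟩; exact hle a P)
  have hq : ∀ P : Finset (Fin N), cubePt Q₀ G P ∈ convexHull ℝ (Set.range (cubePt Q₀ G)) :=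
    fun P => subset_convexHull ℝ _ ⟨P, rfl⟩
  have hv : ∀ p : Finset (Fin n) × Finset (Fin N),
      udPt p.1 + cubePt Q₀ G p.2 ∈ corPolytope n + convexHull ℝ (Set.range (cubePt Q₀ G)) :=
    fun p => Set.add_mem_add (pt_mem p.1) (hq p.2)
  have hvalid : ∀ a, ∀ x ∈ corPolytope n + convexHull ℝ (Set.range (cubePt Q₀ G)),
      exactTilted.ρ n a ⬝ᵥ x ≤ exactTilted.β n a + mm a := by
    rintro a x ⟨p, hp, y, hy, rfl⟩
    rw [dotProduct_add]
    exact add_le_add (exactTilted.valid n a p hp) (hm a y hy)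
  obtain ⟨U, V, hU, hV, hfac⟩ := Literature.Barriers.PneNP.HasEFOfSize.exists_nonneg_factorization hEF
    (fun p : Finset (Fin n) × Finset (Fin N) => udPt p.1 + cubePt Q₀ G p.2) hv (exactTilted.ρ n)
    (fun a => exactTilted.β n a + mm a) hvalid
  exact hn₀ n hn N Q₀ G hz r mm hle hat U V hU hV (fun a b P => hfac a (b, P))

end Cube

end ZgenCube

end Summit.ValiantsHypothesis.ValiantsHypothesis.Theorems.FifoMatching.ExactPencil
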